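import Mathlib
import Summits.Ventures.PercRepro2.Defs
import Summits.Ventures.PercRepro2.Graph
import Summits.Ventures.PercRepro2.Harris
import Summits.Ventures.PercRepro2.RowC1Cross
import Summits.Ventures.PercRepro2.RowC1CrossIdentity

/-!
# The pendant-root cross term of row 2′C1 (blind cell PercRepro2, p2 g34; proofs/P2-G34-ROOT.md §2)

When the root `a₁` is a leaf at `v` with `e = a₁v` its only edge, pinning `e` closed isolates `a₁`,
so `Q = {a₁ ↮ a₂}` is sure: `A⁰ = P⁰(Q) = 1`.  The cross-term identity
`A⁰A¹·c1Cross = (A⁰)²·Row¹ + (A¹)²·Row⁰ + (A⁰C¹ − A¹C⁰)(A⁰D¹ − A¹D⁰)` (RowC1CrossIdentity.lean)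
then reads `A¹·c1Cross = Row¹ + (pendant bracket)` with

  `pendant bracket = (A¹)²·Row⁰ + (C¹ − A¹C⁰)(D¹ − A¹D⁰)` (written out, no new definition)

(`Row⁰ = P(oH, bH) − P(bH)P(oH)` is the Harris slack of the closed world, where `L = {a₁}`,
`U = H`; `C¹ = P¹(Q, bH)`, `D¹ = P¹(Q, oU)`, `C⁰ = P(bH)`, `D⁰ = P(oH)`).  In the vocabulary of
`G − a₁` with root `v`: `bracket / (A¹)² = Cov(o↔a₂, b↔a₂) − [P(b↔a₂) − P(b↔a₂ | v↮a₂)] ·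
[P(o ∈ C(v) ∪ C(a₂) | v↮a₂) − P(o↔a₂)]`, the candidate (Z″) of the seat (exact census clean, equality
for `o` pendant at `v`).  `c1Cross_nonneg_of_pendant`: the cross term at a pendant root is nonnegative as
soon as the row holds for the open pin (the row on `G − a₁` with root `v`) and the pendant bracket is
nonnegative; `c1Cross_pendant_eq` is the identity itself.  Std axioms.
-/

namespace Summit.Ventures.PercRepro2

namespace RowC1

section Pendant

variable {V : Type*} {E : Type*} [Fintype E] [DecidableEq E] [Fintype V] [DecidableEq V]
  {R : Type*} [Field R] [LinearOrder R] [IsStrictOrderedRing R]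

omit [Fintype V] [DecidableEq V] [LinearOrder R] [IsStrictOrderedRing R] in
/-- **The pendant decomposition**: when `P⁰(Q) = 1`,
`A¹ · c1Cross p e = c1Slack p[e↦1] + pendant bracket`. -/
theorem c1Cross_pendant_eq (p : E → R) (ends : E → Sym2 V) (a₁ a₂ o b : V) (e : E)
    (hA0 : prob (Function.update p e (0 : R)) (connEvent ends a₁ a₂)ᶜ = 1) :
    prob (Function.update p e (1 : R)) (connEvent ends a₁ a₂)ᶜ * c1Cross p ends a₁ a₂ o b e =
      c1Slack (Function.update p e (1 : R)) ends a₁ a₂ o b +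
        ((prob (Function.update p e (1 : R)) (connEvent ends a₁ a₂)ᶜ) ^ 2 *
          c1Slack (Function.update p e (0 : R)) ends a₁ a₂ o b +
        (prob (Function.update p e (1 : R)) (connEvent ends a₂ b ∩ (connEvent ends a₁ a₂)ᶜ) -
            prob (Function.update p e (1 : R)) (connEvent ends a₁ a₂)ᶜ *
              prob (Function.update p e (0 : R)) (connEvent ends a₂ b ∩ (connEvent ends a₁ a₂)ᶜ)) *
          (prob (Function.update p e (1 : R))
              ((connEvent ends a₁ o ∪ connEvent ends a₂ o) ∩ (connEvent ends a₁ a₂)ᶜ) -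
            prob (Function.update p e (1 : R)) (connEvent ends a₁ a₂)ᶜ *
              prob (Function.update p e (0 : R))
                ((connEvent ends a₁ o ∪ connEvent ends a₂ o) ∩ (connEvent ends a₁ a₂)ᶜ))) := by
  have h := c1Cross_mul_eq p ends a₁ a₂ o b e
  rw [hA0] at h
  linear_combination h

omit [Fintype V] [DecidableEq V] in
/-- **The cross term at a pendant root** is nonnegative as soon as the row holds for the open pin and
the pendant bracket is nonnegative (if `P¹(Q) = 0` the cross term vanishes). -/
theorem c1Cross_nonneg_of_pendant (p : E → R) (hp : IsProbVec p) (ends : E → Sym2 V)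
    (a₁ a₂ o b : V) (e : E)
    (hA0 : prob (Function.update p e (0 : R)) (connEvent ends a₁ a₂)ᶜ = 1)
    (h1 : 0 ≤ c1Slack (Function.update p e (1 : R)) ends a₁ a₂ o b)
    (hZ : 0 ≤ ((prob (Function.update p e (1 : R)) (connEvent ends a₁ a₂)ᶜ) ^ 2 *
          c1Slack (Function.update p e (0 : R)) ends a₁ a₂ o b +
        (prob (Function.update p e (1 : R)) (connEvent ends a₂ b ∩ (connEvent ends a₁ a₂)ᶜ) -
            prob (Function.update p e (1 : R)) (connEvent ends a₁ a₂)ᶜ *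
              prob (Function.update p e (0 : R)) (connEvent ends a₂ b ∩ (connEvent ends a₁ a₂)ᶜ)) *
          (prob (Function.update p e (1 : R))
              ((connEvent ends a₁ o ∪ connEvent ends a₂ o) ∩ (connEvent ends a₁ a₂)ᶜ) -
            prob (Function.update p e (1 : R)) (connEvent ends a₁ a₂)ᶜ *
              prob (Function.update p e (0 : R))
                ((connEvent ends a₁ o ∪ connEvent ends a₂ o) ∩ (connEvent ends a₁ a₂)ᶜ)))) :
    0 ≤ c1Cross p ends a₁ a₂ o b e := by
  have hA1n : 0 ≤ prob (Function.update p e (1 : R)) (connEvent ends a₁ a₂)ᶜ :=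
    prob_nonneg (hp.update e zero_le_one le_rfl) _
  rcases hA1n.lt_or_eq with hpos | hzero
  · have h := c1Cross_pendant_eq p ends a₁ a₂ o b e hA0
    have hsum : 0 ≤ prob (Function.update p e (1 : R)) (connEvent ends a₁ a₂)ᶜ *
        c1Cross p ends a₁ a₂ o b e := by
      rw [h]; linarith
    exact (mul_nonneg_iff_of_pos_left hpos).1 hsum
  · have hz : prob (Function.update p e (0 : R)) (connEvent ends a₁ a₂)ᶜ *
        prob (Function.update p e (1 : R)) (connEvent ends a₁ a₂)ᶜ = 0 := by
      rw [← hzero, mul_zero]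
    rw [c1Cross_eq_zero_of_mul_eq_zero p hp ends a₁ a₂ o b e hz]

end Pendant

end RowC1

end Summit.Ventures.PercRepro2
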